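import Mathlib
import HarnessLib
import Summits.Ventures.LatticeQCDFlow.Exactness.NCMCGeneralSpaceOccupancyChainStart

/-!
# Hitting probabilities of shift-invariant events are harmonic; running averages define shift-invariant measurable events

HONEST FRAMING: exact (Metropolis-corrected) sampling algorithms for lattice gauge theory;
figures of merit are autocorrelation/cost numbers at stated couplings and volumes; no
continuum-physics claim.

Venture `LatticeQCDFlow` (cell pub-lqcd), topic `Exactness`; FANOUT row 13 (`eng-snf`, GEN-17).
NEW WORK of the cell (textbook Markov-chain facts typed against Mathlib's Ionescu-Tulcea chain
`Kernel.trajMeasure`), not a published result; no definition is introduced; nothing is cited as a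
fact.  Groundwork for `IMHErgodicEveryStart.lean` (the exact flow sampler converges from EVERY
initial configuration): to pass from "almost every start" (`NCMCGeneralSpaceOccupancyChainStart`) to
"every start" one needs (i) that the probability `h_A(z) = P_{δ_z}(A)` of a shift-invariant event is
a HARMONIC function of the start (`h_A = κ h_A`), and (ii) that the event "the running average of
`φ` converges to `L`" is measurable and shift-invariant.

## Content

* §1 `tendsto_cesaro_shift_iff` — `(1/n) Σ_{i<n} φ(x_{i+1}) → L ↔ (1/n) Σ_{i<n} φ(x_i) → L`
  (dropping the first term does not change a Cesàro limit); `preimage_shift_cesaroSet`,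
  `measurableSet_cesaroSet` (Mathlib `measurableSet_tendsto`).
* §2 (any Markov kernel `κ` on `S`; row 8's `Scoring.chain_tower`, `Scoring.chain_map_shift`,
  `Scoring.chain_map_eval_zero`; GEN-17's `trajMeasure_apply_eq_lintegral_dirac`):
  `lintegral_trajMeasure_dirac_comp_eval_one` (`E_z[h_A(X_1)] = P_z(θ⁻¹A)`),
  **`trajMeasure_dirac_eq_lintegral_of_shift_invariant`** — for a measurable `A` with `θ⁻¹A = A`:
  `P_{δ_z}(A) = ∫ P_{δ_y}(A) κ(z, dy)` for EVERY `z`;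
  **`trajMeasure_dirac_ae_eq_one_of_eq_one`** — if moreover `P_π(A) = 1` for a probability law `π`
  then `P_{δ_z}(A) = 1` for `π`-a.e. `z`.

NOT CLAIMED: anything beyond these two facts (no Martin boundary, no Liouville property in general —
that is what a concrete kernel must supply, cf. `IMHErgodicEveryStart.lean`).
-/

namespace Summit.Ventures.LatticeQCDFlow.Exactness.GeneralNCMC

open MeasureTheory ProbabilityTheory Set Filter Finset
open scoped ENNReal Topology

/-! ## §1 Running averages: a shift-invariant measurable event -/

section Cesaro

variable {S : Type*}

/-- **Dropping the first term does not change a Cesàro limit**: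
`(1/n) Σ_{i<n} φ(x_{i+1}) → L ↔ (1/n) Σ_{i<n} φ(x_i) → L`. -/
theorem tendsto_cesaro_shift_iff (φ : S → ℝ) (x : ℕ → S) (L : ℝ) :
    Tendsto (fun n : ℕ => (∑ i ∈ range n, φ (x (i + 1))) / n) atTop (𝓝 L) ↔
      Tendsto (fun n : ℕ => (∑ i ∈ range n, φ (x i)) / n) atTop (𝓝 L) := by
  -- `a (n+1) = φ(x 0) + b n`
  have hsucc : ∀ n : ℕ, ∑ i ∈ range (n + 1), φ (x i) = φ (x 0) + ∑ i ∈ range n, φ (x (i + 1)) := by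
    intro n
    rw [Finset.sum_range_succ' (fun i => φ (x i)) n, add_comm]
  have h1 : Tendsto (fun n : ℕ => φ (x 0) / ((n : ℝ) + 1)) atTop (𝓝 0) := by
    have := (tendsto_one_div_add_atTop_nhds_zero_nat).const_mul (φ (x 0))
    rw [mul_zero] at this
    refine this.congr fun n => ?_
    rw [mul_one_div]
  have h2 : Tendsto (fun n : ℕ => (n : ℝ) / ((n : ℝ) + 1)) atTop (𝓝 1) :=
    tendsto_natCast_div_add_atTop 1
  have h3 : Tendsto (fun n : ℕ => ((n : ℝ) + 1) / n) atTop (𝓝 1) := by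
    have := tendsto_const_nhds.add tendsto_one_div_atTop_nhds_zero_nat (a := (1 : ℝ))
    rw [add_zero] at this
    refine this.congr' ?_
    filter_upwards [eventually_gt_atTop 0] with n hn
    have hn' : (n : ℝ) ≠ 0 := by exact_mod_cast hn.ne'
    field_simp
  have h4 : Tendsto (fun n : ℕ => φ (x 0) / (n : ℝ)) atTop (𝓝 0) := by
    have := (tendsto_one_div_atTop_nhds_zero_nat).const_mul (φ (x 0))
    rw [mul_zero] at this
    refine this.congr fun n => ?_
    rw [mul_one_div]
  constructor
  · intro hb
    -- `a (n+1)/(n+1) = φ(x 0)/(n+1) + (b n / n) (n/(n+1)) → L`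
    rw [← tendsto_add_atTop_iff_nat 1]
    have key : Tendsto (fun n : ℕ => φ (x 0) / ((n : ℝ) + 1) +
        (∑ i ∈ range n, φ (x (i + 1))) / n * ((n : ℝ) / ((n : ℝ) + 1))) atTop (𝓝 L) := by
      have := h1.add (hb.mul h2)
      rw [zero_add, mul_one] at this
      exact this
    refine key.congr' ?_
    filter_upwards [eventually_gt_atTop 0] with n hn
    have hn' : (n : ℝ) ≠ 0 := by exact_mod_cast hn.ne'
    rw [hsucc n, Nat.cast_add, Nat.cast_one]
    field_simp
  · intro ha
    -- `b n / n = (a (n+1)/(n+1)) ((n+1)/n) − φ(x 0)/n → L`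
    have ha' : Tendsto (fun n : ℕ => (∑ i ∈ range (n + 1), φ (x i)) / ((n : ℝ) + 1)) atTop
        (𝓝 L) := by
      have := (tendsto_add_atTop_iff_nat 1).2 ha
      refine this.congr fun n => ?_
      rw [Nat.cast_add, Nat.cast_one]
    have key : Tendsto (fun n : ℕ => (∑ i ∈ range (n + 1), φ (x i)) / ((n : ℝ) + 1) *
        (((n : ℝ) + 1) / n) - φ (x 0) / (n : ℝ)) atTop (𝓝 L) := by
      have := (ha'.mul h3).sub h4
      rw [mul_one, sub_zero] at this
      exact this
    refine key.congr' ?_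
    filter_upwards [eventually_gt_atTop 0] with n hn
    have hn' : (n : ℝ) ≠ 0 := by exact_mod_cast hn.ne'
    have hn1 : (n : ℝ) + 1 ≠ 0 := by positivity
    rw [hsucc n]
    field_simp
    ring

/-- The event "the running average of `φ` converges to `L`" is invariant under the shift. -/
theorem preimage_shift_cesaroSet (φ : S → ℝ) (L : ℝ) :
    (fun (x : ℕ → S) (k : ℕ) => x (k + 1)) ⁻¹'
        {x : ℕ → S | Tendsto (fun n : ℕ => (∑ i ∈ range n, φ (x i)) / n) atTop (𝓝 L)} =
      {x : ℕ → S | Tendsto (fun n : ℕ => (∑ i ∈ range n, φ (x i)) / n) atTop (𝓝 L)} := by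
  ext x
  exact tendsto_cesaro_shift_iff φ x L

variable [MeasurableSpace S]

/-- The event "the running average of `φ` converges to `L`" is measurable (`φ` measurable). -/
theorem measurableSet_cesaroSet {φ : S → ℝ} (hφ : Measurable φ) (L : ℝ) :
    MeasurableSet
      {x : ℕ → S | Tendsto (fun n : ℕ => (∑ i ∈ range n, φ (x i)) / n) atTop (𝓝 L)} :=
  measurableSet_tendsto (𝓝 L) fun n =>
    (Finset.measurable_sum (range n) fun i _ => hφ.comp (measurable_pi_apply i)).div_const _

end Cesaro

/-! ## §2 Hitting probabilities of shift-invariant events are harmonic -/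

section Harmonic

variable {S : Type*} [MeasurableSpace S] (κ : Kernel S S) [IsMarkovKernel κ]

/-- `E_{δ_z}[h_A(X_1)] = P_{δ_z}(θ⁻¹ A)` for a measurable `A` (`h_A(y) = P_{δ_y}(A)`): the Markov
property at time one (row 8's `chain_map_shift`) disintegrated over the state at time one. -/
theorem lintegral_trajMeasure_dirac_comp_eval_one (z : S) {A : Set (ℕ → S)} (hA : MeasurableSet A) :
    ∫⁻ x, Kernel.trajMeasure (X := fun _ : ℕ => S) (Measure.dirac (x 1))
        (fun n : ℕ => κ.comap (fun h : (j : ↥(Finset.Iic n)) → S => h ⟨n, Finset.mem_Iic.2 le_rfl⟩)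
          (measurable_pi_apply _)) A
      ∂(Kernel.trajMeasure (X := fun _ : ℕ => S) (Measure.dirac z)
        (fun n : ℕ => κ.comap (fun h : (j : ↥(Finset.Iic n)) → S => h ⟨n, Finset.mem_Iic.2 le_rfl⟩)
          (measurable_pi_apply _))) =
      Kernel.trajMeasure (X := fun _ : ℕ => S) (Measure.dirac z)
        (fun n : ℕ => κ.comap (fun h : (j : ↥(Finset.Iic n)) → S => h ⟨n, Finset.mem_Iic.2 le_rfl⟩)
          (measurable_pi_apply _)) ((fun (x : ℕ → S) (k : ℕ) => x (k + 1)) ⁻¹' A) := by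
  set P := Kernel.trajMeasure (X := fun _ : ℕ => S) (Measure.dirac z)
    (fun n : ℕ => κ.comap (fun h : (j : ↥(Finset.Iic n)) → S => h ⟨n, Finset.mem_Iic.2 le_rfl⟩)
      (measurable_pi_apply _)) with hP
  have hshift := Scoring.chain_map_shift κ (Measure.dirac z) 1
  rw [← hP] at hshift
  have hfun : (fun (x : ℕ → S) (k : ℕ) => x (k + 1)) = fun (x : ℕ → S) (n : ℕ) => x (1 + n) := by
    funext x n
    rw [Nat.add_comm]
  rw [hfun, ← Measure.map_apply (measurable_pi_lambda _ fun n => measurable_pi_apply _) hA, hshift,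
    trajMeasure_apply_eq_lintegral_dirac κ _ hA,
    lintegral_map (measurable_trajMeasure_dirac κ hA) (measurable_pi_apply 1)]

/-- **HARMONICITY.**  For a measurable shift-invariant event `A` (`θ⁻¹ A = A`), the hitting
probability `h_A(z) = P_{δ_z}(A)` satisfies `h_A(z) = ∫ h_A(y) κ(z, dy)` for EVERY `z`. -/
theorem trajMeasure_dirac_eq_lintegral_of_shift_invariant {A : Set (ℕ → S)} (hA : MeasurableSet A)
    (hinv : (fun (x : ℕ → S) (k : ℕ) => x (k + 1)) ⁻¹' A = A) (z : S) :
    Kernel.trajMeasure (X := fun _ : ℕ => S) (Measure.dirac z)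
        (fun n : ℕ => κ.comap (fun h : (j : ↥(Finset.Iic n)) → S => h ⟨n, Finset.mem_Iic.2 le_rfl⟩)
          (measurable_pi_apply _)) A =
      ∫⁻ y, Kernel.trajMeasure (X := fun _ : ℕ => S) (Measure.dirac y)
        (fun n : ℕ => κ.comap (fun h : (j : ↥(Finset.Iic n)) → S => h ⟨n, Finset.mem_Iic.2 le_rfl⟩)
          (measurable_pi_apply _)) A ∂(κ z) := by
  set P := Kernel.trajMeasure (X := fun _ : ℕ => S) (Measure.dirac z)
    (fun n : ℕ => κ.comap (fun h : (j : ↥(Finset.Iic n)) → S => h ⟨n, Finset.mem_Iic.2 le_rfl⟩)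
      (measurable_pi_apply _)) with hP
  -- the real-valued hitting probability
  set hR : S → ℝ := fun y => (Kernel.trajMeasure (X := fun _ : ℕ => S) (Measure.dirac y)
    (fun n : ℕ => κ.comap (fun h : (j : ↥(Finset.Iic n)) → S => h ⟨n, Finset.mem_Iic.2 le_rfl⟩)
      (measurable_pi_apply _))).real A with hhR
  have hRm : Measurable hR := (measurable_trajMeasure_dirac κ hA).ennreal_toReal
  have hR01 : ∀ y, |hR y| ≤ 1 := fun y => by
    rw [abs_of_nonneg measureReal_nonneg]
    exact measureReal_le_one
  -- step 1: `P(A) = P(θ⁻¹A) = E_z[h(X_1)]` (in real form)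
  have h1 : P.real A = ∫ x, hR (x 1) ∂P := by
    have e1 := lintegral_trajMeasure_dirac_comp_eval_one κ z hA
    rw [hinv, ← hP] at e1
    simp only [hhR, measureReal_def]
    have hm1 : Measurable fun x : ℕ → S => Kernel.trajMeasure (X := fun _ : ℕ => S)
        (Measure.dirac (x 1))
        (fun n : ℕ => κ.comap (fun h : (j : ↥(Finset.Iic n)) → S => h ⟨n, Finset.mem_Iic.2 le_rfl⟩)
          (measurable_pi_apply _)) A :=
      (measurable_trajMeasure_dirac κ hA).comp (measurable_pi_apply 1)
    rw [← e1, integral_toReal hm1.aemeasurable (Eventually.of_forall fun _ => measure_lt_top _ _)]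
  -- step 2: `E_z[h(X_1)] = E_z[(κ h)(X_0)]` (tower property at time `0`)
  set G : S → ℝ := fun y => (∫⁻ y', Kernel.trajMeasure (X := fun _ : ℕ => S) (Measure.dirac y')
    (fun n : ℕ => κ.comap (fun h : (j : ↥(Finset.Iic n)) → S => h ⟨n, Finset.mem_Iic.2 le_rfl⟩)
      (measurable_pi_apply _)) A ∂(κ y)).toReal with hG
  have hGm : Measurable G := ((measurable_trajMeasure_dirac κ hA).lintegral_kernel).ennreal_toReal
  have hkop : Scoring.kop κ hR = G := by
    funext y
    simp only [Scoring.kop, hhR, hG, measureReal_def]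
    exact integral_toReal (measurable_trajMeasure_dirac κ hA).aemeasurable
      (Eventually.of_forall fun _ => measure_lt_top _ _)
  have h2 : ∫ x, hR (x 1) ∂P = ∫ x, G (x 0) ∂P := by
    have key := Scoring.chain_tower κ (Measure.dirac z) 0 (F := fun _ => (1 : ℝ)) measurable_const
      (CF := 1) (fun _ => by simp) hRm (Cg := 1) hR01
    simp only [one_mul, Nat.zero_add] at key
    rw [← hP, hkop] at key
    exact key
  -- step 3: the time-`0` marginal of `P_{δ_z}` is `δ_z`
  have h3 : ∫ x, G (x 0) ∂P = G z := by
    rw [← integral_map (measurable_pi_apply 0).aemeasurable hGm.aestronglyMeasurable, hP,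
      Scoring.chain_map_eval_zero κ (Measure.dirac z), integral_dirac' _ _ hGm.stronglyMeasurable]
  -- conclude in `ℝ≥0∞`
  have hfin : ∫⁻ y, Kernel.trajMeasure (X := fun _ : ℕ => S) (Measure.dirac y)
      (fun n : ℕ => κ.comap (fun h : (j : ↥(Finset.Iic n)) → S => h ⟨n, Finset.mem_Iic.2 le_rfl⟩)
        (measurable_pi_apply _)) A ∂(κ z) ≠ ∞ := by
    refine ne_top_of_le_ne_top ENNReal.one_ne_top ?_
    calc ∫⁻ y, Kernel.trajMeasure (X := fun _ : ℕ => S) (Measure.dirac y)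
          (fun n : ℕ => κ.comap (fun h : (j : ↥(Finset.Iic n)) → S => h ⟨n, Finset.mem_Iic.2 le_rfl⟩)
            (measurable_pi_apply _)) A ∂(κ z) ≤ ∫⁻ _, 1 ∂(κ z) := lintegral_mono fun _ => prob_le_one
      _ = 1 := by rw [lintegral_const, measure_univ, mul_one]
  have hreal : P.real A = G z := h1.trans (h2.trans h3)
  rw [measureReal_def, hG] at hreal
  exact (ENNReal.toReal_eq_toReal_iff' (measure_ne_top _ _) hfin).1 hreal

/-- **If a shift-invariant event is almost sure for the chain from `π`, it is almost sure from
`π`-almost every point** — in the sharp form `P_{δ_z}(A) = 1` (not only `> 0`). -/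
theorem trajMeasure_dirac_ae_eq_one_of_eq_one {π : Measure S} [IsProbabilityMeasure π]
    {A : Set (ℕ → S)} (hA : MeasurableSet A)
    (hπA : Kernel.trajMeasure (X := fun _ : ℕ => S) π
      (fun n : ℕ => κ.comap (fun h : (j : ↥(Finset.Iic n)) → S => h ⟨n, Finset.mem_Iic.2 le_rfl⟩)
        (measurable_pi_apply _)) A = 1) :
    ∀ᵐ z ∂π, Kernel.trajMeasure (X := fun _ : ℕ => S) (Measure.dirac z)
      (fun n : ℕ => κ.comap (fun h : (j : ↥(Finset.Iic n)) → S => h ⟨n, Finset.mem_Iic.2 le_rfl⟩)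
        (measurable_pi_apply _)) A = 1 := by
  have hm := measurable_trajMeasure_dirac κ hA
  have hint : ∫⁻ z, Kernel.trajMeasure (X := fun _ : ℕ => S) (Measure.dirac z)
      (fun n : ℕ => κ.comap (fun h : (j : ↥(Finset.Iic n)) → S => h ⟨n, Finset.mem_Iic.2 le_rfl⟩)
        (measurable_pi_apply _)) A ∂π = 1 := by
    rw [← trajMeasure_apply_eq_lintegral_dirac κ π hA, hπA]
  have hsub : ∫⁻ z, (1 - Kernel.trajMeasure (X := fun _ : ℕ => S) (Measure.dirac z)
      (fun n : ℕ => κ.comap (fun h : (j : ↥(Finset.Iic n)) → S => h ⟨n, Finset.mem_Iic.2 le_rfl⟩)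
        (measurable_pi_apply _)) A) ∂π = 0 := by
    rw [lintegral_sub hm (by rw [hint]; exact ENNReal.one_ne_top)
      (Eventually.of_forall fun _ => prob_le_one), lintegral_const, measure_univ, mul_one, hint,
      tsub_self]
  have hm' : Measurable fun z => 1 - Kernel.trajMeasure (X := fun _ : ℕ => S) (Measure.dirac z)
      (fun n : ℕ => κ.comap (fun h : (j : ↥(Finset.Iic n)) → S => h ⟨n, Finset.mem_Iic.2 le_rfl⟩)
        (measurable_pi_apply _)) A := measurable_const.sub hm
  rw [lintegral_eq_zero_iff hm'] at hsub
  filter_upwards [hsub] with z hz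
  exact le_antisymm prob_le_one (tsub_eq_zero_iff_le.1 hz)

end Harmonic

end Summit.Ventures.LatticeQCDFlow.Exactness.GeneralNCMC
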